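import Mathlib
import HarnessLib

/-!
# Crux `NoZenoR` / `NoZeno` (stmt-ResolutionOfSingularities-19943 / -16483), β2 descent, `stub_L1wCore` (F1) route,
# BC-2a (fibre half, point-wise): the residue field of a point of `X ×_S Y` is a residue field of `κ(x) ⊗_{κ(s)} κ(y)`

OURS (cell res-hironaka, chain W4.4; stub worker res-L0-w44-stub-2 g12; brick DAG `L1W-PREP-v2.md` 95253e48ec58b05c
§2.1 D3/D5, brick BC-2).  Pure scheme theory over Mathlib's `AlgebraicGeometry.Scheme.Pullback.Triplet` API
(`Mathlib/AlgebraicGeometry/PullbackCarrier`); nothing here is a statement of the manuscript under review (Hironaka 2017);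
AI-written, weaker than expert review.

For `f : X → S`, `g : Y → S`, a triplet `T = (x, y, s)` and a prime `p` of `T.tensor = κ(x) ⊗_{κ(s)} κ(y)`, Mathlib's
`T.SpecTensorTo p` is the point `ζ` of `X ×_S Y` over `(x, y)` attached to `p` (`Scheme.Pullback.carrierEquiv`).

* `tensorCongr_ofPointTensor_residueFieldMap` — the ring-level form of Mathlib's
  `Triplet.Spec_ofPointTensor_SpecTensorTo`: `T.tensor → κ(ζ) → κ_{Spec T.tensor}(p)` is the canonical map
  `T.tensor → κ(p)`;
* `residueFieldMap_specTensorTo_bijective` — for `p` MAXIMAL (e.g. `κ(y)/κ(s)` finite), `κ(ζ) → κ(p)` is bijective,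
  and `ofPointTensor_surjective`: `κ(x) ⊗ κ(y) → κ(ζ)` is onto, `ker_ofPointTensor`: with kernel the prime of `ζ`;
* `tensorInr_tensorCongr_hom` / `tensorInl_tensorCongr_hom` — bookkeeping for Mathlib's `tensorCongr`;
* `finrank_separableClosure_eq_of_ringEquiv` — the separable degree `[F^s : K]` of a field pair `K → F` is invariant
  under isomorphisms of pairs;
* **`finrank_separableClosure_residueField_specTensorTo`** — the separable degree of `κ(ζ)` over `κ(g-side point)`
  (through `pullback.snd`) equals that of `κ(p) = p.ResidueField` over `κ(y)` (through `tensorInr`): the split weight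
  of a point of the base change is computed in the tensor product of residue fields;
* `specTensorTo_injective`, `exists_specTensorTo_eq`, `bijOn_specTensorTo` — the fibre over `(x, y)` is in bijection
  with `Spec T.tensor`;
* `exists_tensorIso` — `T.tensor ≅ κ(x) ⊗_{κ(s)} κ(y)` compatibly with `tensorInl`/`tensorInr`
  (`CommRingCat.isPushout_tensorProduct`); `isArtinianRing_tensor`, `isMaximal_of_finite`, `finite_spec_tensor` —
  for `κ(y)/κ(s)` finite the fibre is finite and all its primes are maximal.
-/

noncomputable section

-- single-problem summit: the doubled namespace component `ResolutionOfSingularities` is forced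
set_option linter.dupNamespace false

namespace Summit.ResolutionOfSingularities.ResolutionOfSingularities.Theorems.NoZeno.ExcCount

open CategoryTheory CategoryTheory.Limits AlgebraicGeometry AlgebraicGeometry.Scheme.Pullback IsLocalRing TensorProduct

universe u

/-! ## Separable degree is invariant under isomorphisms of field pairs -/

section Transport

/-- **`[F₁^s : K₁] = [F₂^s : K₂]` for isomorphic pairs**: ring isomorphisms `e₀ : K₁ ≃ K₂`, `e₁ : F₁ ≃ F₂`
intertwining the structure maps `j₁ : K₁ → F₁`, `j₂ : K₂ → F₂` identify the separable closures and their degrees.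
[folklore] -/
theorem finrank_separableClosure_eq_of_ringEquiv {K₁ K₂ F₁ F₂ : Type*} [Field K₁] [Field K₂] [Field F₁]
    [Field F₂] (j₁ : K₁ →+* F₁) (j₂ : K₂ →+* F₂) (e₀ : K₁ ≃+* K₂) (e₁ : F₁ ≃+* F₂)
    (hcomm : ∀ a, e₁ (j₁ a) = j₂ (e₀ a)) :
    letI := j₁.toAlgebra
    letI := j₂.toAlgebra
    Module.finrank K₁ (separableClosure K₁ F₁) = Module.finrank K₂ (separableClosure K₂ F₂) := by
  letI := j₁.toAlgebra
  letI := j₂.toAlgebra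
  -- `F₂` as a `K₁`-algebra through `e₀`, making `K₁ → K₂ → F₂` a tower and `e₁` a `K₁`-algebra isomorphism
  letI : Algebra K₁ K₂ := e₀.toRingHom.toAlgebra
  letI hA : Algebra K₁ F₂ := (j₂.comp e₀.toRingHom).toAlgebra
  haveI : IsScalarTower K₁ K₂ F₂ := IsScalarTower.of_algebraMap_eq (fun _ => rfl)
  let e₁' : F₁ ≃ₐ[K₁] F₂ :=
    { e₁ with
      commutes' := fun a => by
        change e₁ (j₁ a) = j₂ (e₀ a)
        exact hcomm a }
  -- (1) transport along `e₁'`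
  have h1 : Module.finrank K₁ (separableClosure K₁ F₁) = Module.finrank K₁ (separableClosure K₁ F₂) :=
    (separableClosure.algEquivOfAlgEquiv e₁').toLinearEquiv.finrank_eq
  -- (2) change the base field along the isomorphism `K₁ ≃ K₂` (a tower `K₁ → K₂ → F₂` with `[K₂ : K₁] = 1`)
  let eK : K₁ ≃ₐ[K₁] K₂ := { e₀ with commutes' := fun _ => rfl }
  haveI : Algebra.IsSeparable K₁ K₂ := AlgEquiv.Algebra.isSeparable eK
  have h2 : separableClosure K₁ F₂ = (separableClosure K₂ F₂).restrictScalars K₁ :=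
    separableClosure.eq_restrictScalars_of_isSeparable K₁ K₂ F₂
  have h3 : Module.finrank K₁ (separableClosure K₁ F₂) =
      Module.finrank K₁ ((separableClosure K₂ F₂).restrictScalars K₁) := by rw [h2]
  have h4 : Module.finrank K₁ ((separableClosure K₂ F₂).restrictScalars K₁) =
      Module.finrank K₁ (separableClosure K₂ F₂) := rfl
  have hK : Module.finrank K₁ K₂ = 1 := by
    rw [← eK.toLinearEquiv.finrank_eq, Module.finrank_self]
  have h5 : Module.finrank K₁ (separableClosure K₂ F₂) = Module.finrank K₂ (separableClosure K₂ F₂) := by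
    rw [← Module.finrank_mul_finrank K₁ K₂ (separableClosure K₂ F₂), hK, one_mul]
  rw [h1, h3, h4, h5]

end Transport

/-! ## Residue fields of the points of `X ×_S Y` -/

section Pullback

variable {X Y S : Scheme.{u}} {f : X ⟶ S} {g : Y ⟶ S}

/-- `tensorInr` under Mathlib's `tensorCongr` (an `eqToIso`). [folklore] -/
theorem tensorInr_tensorCongr_hom {T₁ T₂ : Triplet f g} (h : T₁ = T₂) :
    T₁.tensorInr ≫ (Triplet.tensorCongr h).hom = (Y.residueFieldCongr (congrArg Triplet.y h)).hom ≫ T₂.tensorInr := by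
  subst h
  simp [Triplet.tensorCongr_refl, Scheme.residueFieldCongr_refl]

/-- `tensorInl` under Mathlib's `tensorCongr`. [folklore] -/
theorem tensorInl_tensorCongr_hom {T₁ T₂ : Triplet f g} (h : T₁ = T₂) :
    T₁.tensorInl ≫ (Triplet.tensorCongr h).hom = (X.residueFieldCongr (congrArg Triplet.x h)).hom ≫ T₂.tensorInl := by
  subst h
  simp [Triplet.tensorCongr_refl, Scheme.residueFieldCongr_refl]

/-- The kernel of `κ(x) ⊗_{κ(s)} κ(y) → κ(t)` is the prime attached to `t` by `carrierEquiv`. [folklore] -/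
theorem ker_ofPointTensor (t : ↑(pullback f g)) :
    RingHom.ker (ofPointTensor t).hom = (SpecOfPoint t).asIdeal := by
  rw [SpecOfPoint, AlgebraicGeometry.Spec.map_apply, PrimeSpectrum.comap_asIdeal, RingHom.ker_eq_comap_bot]
  rfl

/-- Ring-level form of Mathlib's `Triplet.Spec_ofPointTensor_SpecTensorTo`: for `ζ = T.SpecTensorTo p`, the composite
`T.tensor ≅ (ofPoint ζ).tensor → κ(ζ) → κ_{Spec T.tensor}(p)` is the canonical map `T.tensor → κ(p)`. [folklore] -/
theorem tensorCongr_ofPointTensor_residueFieldMap (T : Triplet f g) (p : Spec T.tensor) :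
    (Triplet.tensorCongr (T.ofPoint_SpecTensorTo p).symm).hom ≫ ofPointTensor (T.SpecTensorTo p) ≫
        (T.SpecTensorTo).residueFieldMap p =
      CommRingCat.ofHom (algebraMap T.tensor p.asIdeal.ResidueField) ≫
        (Scheme.Spec.residueFieldIso T.tensor p).inv := by
  apply Spec.map_injective
  simp only [Spec.map_comp, Category.assoc]
  rw [Triplet.Spec_ofPointTensor_SpecTensorTo, Scheme.Spec.map_residueFieldIso_inv_eq_fromSpecResidueField]

/-- Element form of `tensorCongr_ofPointTensor_residueFieldMap`. [folklore] -/
theorem residueFieldMap_ofPointTensor_tensorCongr_apply (T : Triplet f g) (p : Spec T.tensor) (a : T.tensor) :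
    ((T.SpecTensorTo).residueFieldMap p).hom ((ofPointTensor (T.SpecTensorTo p)).hom
        ((Triplet.tensorCongr (T.ofPoint_SpecTensorTo p).symm).hom.hom a)) =
      (Scheme.Spec.residueFieldIso T.tensor p).inv.hom (algebraMap T.tensor p.asIdeal.ResidueField a) := by
  have h := congrArg (fun φ => φ.hom a) (tensorCongr_ofPointTensor_residueFieldMap T p)
  simpa only [CommRingCat.hom_comp, RingHom.comp_apply, CommRingCat.hom_ofHom] using h

/-- **For a maximal `p`, `κ(ζ) → κ_{Spec T.tensor}(p)` is bijective** (`ζ = T.SpecTensorTo p`): it is a field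
homomorphism, and it is onto because `T.tensor → κ(p)` is. [this work] -/
theorem residueFieldMap_specTensorTo_bijective (T : Triplet f g) (p : Spec T.tensor) [p.asIdeal.IsMaximal] :
    Function.Bijective ((T.SpecTensorTo).residueFieldMap p).hom := by
  refine ⟨((T.SpecTensorTo).residueFieldMap p).hom.injective, fun c => ?_⟩
  -- `c = iso.inv (algebraMap a')` for some `a'`, since `T.tensor → p.ResidueField` is onto for `p` maximal
  obtain ⟨b, hb⟩ := (Scheme.Spec.residueFieldIso T.tensor p).commRingCatIsoToRingEquiv.symm.surjective c
  obtain ⟨a, ha⟩ := Ideal.algebraMap_residueField_surjective p.asIdeal b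
  refine ⟨(ofPointTensor (T.SpecTensorTo p)).hom
    ((Triplet.tensorCongr (T.ofPoint_SpecTensorTo p).symm).hom.hom a), ?_⟩
  rw [residueFieldMap_ofPointTensor_tensorCongr_apply, ha, ← hb]
  rfl

/-- **`κ(x) ⊗_{κ(s)} κ(y) → κ(t)` is onto when the prime of `t` is maximal** (e.g. `κ(y)` finite over `κ(s)`).
[this work] -/
theorem ofPointTensor_surjective (t : ↑(pullback f g)) (ht : (SpecOfPoint t).asIdeal.IsMaximal) :
    Function.Surjective (ofPointTensor t).hom := by
  -- work at `ζ := T.SpecTensorTo p` for `T := ofPoint t`, `p := SpecOfPoint t`, then `ζ = t`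
  have key : ∀ (T : Triplet f g) (p : Spec T.tensor), p.asIdeal.IsMaximal →
      Function.Surjective (ofPointTensor (T.SpecTensorTo p)).hom := by
    intro T p hp c
    -- a preimage under `ofPointTensor`: surjectivity of `T.tensor → κ(p)` and injectivity of `κ(ζ) → κ(p)`
    obtain ⟨b, hb⟩ := (Scheme.Spec.residueFieldIso T.tensor p).commRingCatIsoToRingEquiv.symm.surjective
      (((T.SpecTensorTo).residueFieldMap p).hom c)
    obtain ⟨a, ha⟩ := Ideal.algebraMap_residueField_surjective p.asIdeal b
    refine ⟨(Triplet.tensorCongr (T.ofPoint_SpecTensorTo p).symm).hom.hom a, ?_⟩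
    apply ((T.SpecTensorTo).residueFieldMap p).hom.injective
    rw [residueFieldMap_ofPointTensor_tensorCongr_apply, ha, ← hb]
    rfl
  have h := key (Triplet.ofPoint t) (SpecOfPoint t) ht
  rwa [SpecTensorTo_SpecOfPoint] at h

/-- **The split weight of a point of the base change is computed in the tensor product of residue fields**:
for `ζ = T.SpecTensorTo p` with `p` maximal, the separable degree of `κ(ζ)` over `κ(pullback.snd ζ)` (structure map
`(pullback.snd f g).residueFieldMap ζ`) equals the separable degree of `κ(p) = p.ResidueField` over `κ(y)` (structure
map `T.tensor → κ(p)` after `tensorInr : κ(y) → T.tensor`). [this work] -/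
theorem finrank_separableClosure_residueField_specTensorTo (T : Triplet f g) (p : Spec T.tensor)
    [p.asIdeal.IsMaximal] :
    letI := ((pullback.snd f g).residueFieldMap (T.SpecTensorTo p)).hom.toAlgebra
    letI := ((algebraMap T.tensor p.asIdeal.ResidueField).comp T.tensorInr.hom).toAlgebra
    Module.finrank (Y.residueField (pullback.snd f g (T.SpecTensorTo p)))
        (separableClosure (Y.residueField (pullback.snd f g (T.SpecTensorTo p)))
          ((pullback f g).residueField (T.SpecTensorTo p))) =
      Module.finrank (Y.residueField T.y) (separableClosure (Y.residueField T.y) p.asIdeal.ResidueField) := by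
  set ζ := T.SpecTensorTo p with hζ
  have hT : T = Triplet.ofPoint ζ := (T.ofPoint_SpecTensorTo p).symm
  -- the isomorphisms of the pair: base `κ(snd ζ) = κ((ofPoint ζ).y) ≅ κ(T.y)`, top `κ(ζ) ≅ κ(p) ≅ p.ResidueField`
  let e₀ : Y.residueField (pullback.snd f g ζ) ≃+* Y.residueField T.y :=
    (Y.residueFieldCongr (congrArg Triplet.y hT)).commRingCatIsoToRingEquiv.symm
  let e₁ : (pullback f g).residueField ζ ≃+* p.asIdeal.ResidueField :=
    (RingEquiv.ofBijective _ (residueFieldMap_specTensorTo_bijective T p)).trans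
      (Scheme.Spec.residueFieldIso T.tensor p).commRingCatIsoToRingEquiv
  refine finrank_separableClosure_eq_of_ringEquiv _ _ e₀ e₁ fun a => ?_
  -- compatibility, from `tensorInr T ≫ tc.hom = congr ≫ tensorInr (ofPoint ζ)`, `tensorInr (ofPoint ζ) ≫ opt = rfm`
  have h1 : ∀ c, (Triplet.tensorCongr hT).hom.hom (T.tensorInr.hom c) =
      (Triplet.ofPoint ζ).tensorInr.hom ((Y.residueFieldCongr (congrArg Triplet.y hT)).hom.hom c) := by
    intro c
    have h := congrArg (fun φ => φ.hom c) (tensorInr_tensorCongr_hom hT)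
    simpa only [CommRingCat.hom_comp, RingHom.comp_apply] using h
  have h2 : ∀ b, (ofPointTensor ζ).hom ((Triplet.ofPoint ζ).tensorInr.hom b) =
      ((pullback.snd f g).residueFieldMap ζ).hom b := by
    intro b
    have h := congrArg (fun φ => φ.hom b) (pushout.inr_desc ((pullback.fst f g).residueFieldMap ζ)
      ((pullback.snd f g).residueFieldMap ζ) (residueFieldCongr_inv_residueFieldMap_ofPoint ζ))
    simp only [CommRingCat.hom_comp, RingHom.comp_apply] at h
    exact h
  have ha : (Y.residueFieldCongr (congrArg Triplet.y hT)).hom.hom (e₀ a) = a :=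
    (Y.residueFieldCongr (congrArg Triplet.y hT)).inv_hom_id_apply a
  have h3 : ((pullback.snd f g).residueFieldMap ζ).hom a =
      (ofPointTensor ζ).hom ((Triplet.tensorCongr hT).hom.hom (T.tensorInr.hom (e₀ a))) := by
    rw [h1, ha, h2]
  change (Scheme.Spec.residueFieldIso T.tensor p).hom.hom
      (((T.SpecTensorTo).residueFieldMap p).hom (((pullback.snd f g).residueFieldMap ζ).hom a)) =
    algebraMap T.tensor p.asIdeal.ResidueField (T.tensorInr.hom (e₀ a))
  rw [h3, residueFieldMap_ofPointTensor_tensorCongr_apply, Iso.inv_hom_id_apply]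


/-! ## The points over `(x, y)`: `Spec T.tensor` in bijection with the fibre -/

/-- `p ↦ T.SpecTensorTo p` is injective (`carrierEquiv`). [folklore] -/
theorem specTensorTo_injective (T : Triplet f g) :
    Function.Injective fun p : Spec T.tensor => T.SpecTensorTo p := by
  intro p p' h
  have h' : (carrierEquiv (f := f) (g := g)).symm ⟨T, p⟩ = carrierEquiv.symm ⟨T, p'⟩ := h
  have h'' := carrierEquiv.symm.injective h'
  simp only [Sigma.mk.injEq, heq_eq_eq, true_and] at h''
  exact h''

/-- Every point `t` over `(T.x, T.y)` is `T.SpecTensorTo p` for some prime `p` of `T.tensor`. [folklore] -/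
theorem exists_specTensorTo_eq (T : Triplet f g) (t : ↑(pullback f g)) (hx : pullback.fst f g t = T.x)
    (hy : pullback.snd f g t = T.y) : ∃ p : Spec T.tensor, T.SpecTensorTo p = t := by
  have hT : T = Triplet.ofPoint t := (Triplet.ext (t₁ := Triplet.ofPoint t) hx hy).symm
  refine ⟨Spec.map (Triplet.tensorCongr hT).hom (SpecOfPoint t), ?_⟩
  rw [← Scheme.Hom.comp_apply, tensorCongr_SpecTensorTo, SpecTensorTo_SpecOfPoint]

/-- **The fibre of `X ×_S Y → X × Y` over `(x, y)` is `Spec (κ(x) ⊗_{κ(s)} κ(y))`** as a set: `p ↦ T.SpecTensorTo p`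
is a bijection onto `{t | fst t = x, snd t = y}`. [folklore] -/
theorem bijOn_specTensorTo (T : Triplet f g) :
    Set.BijOn (fun p : Spec T.tensor => T.SpecTensorTo p) Set.univ
      {t | pullback.fst f g t = T.x ∧ pullback.snd f g t = T.y} := by
  refine ⟨fun p _ => ⟨Triplet.fst_SpecTensorTo_apply T p, Triplet.snd_SpecTensorTo_apply T p⟩,
    (specTensorTo_injective T).injOn, fun t ht => ?_⟩
  obtain ⟨p, hp⟩ := exists_specTensorTo_eq T t ht.1 ht.2
  exact ⟨p, Set.mem_univ _, hp⟩

/-! ## `T.tensor` is the tensor product of the residue fields -/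

/-- **`T.tensor ≅ κ(x) ⊗_{κ(s)} κ(y)`** compatibly with the two structure maps (Mathlib's `T.tensor` is the
abstract pushout in `CommRingCat`; `CommRingCat.isPushout_tensorProduct`). The `κ(s)`-algebra structures on `κ(x)`,
`κ(y)` are the ones of the triplet (`f.residueFieldMap x`, `g.residueFieldMap y` after `residueFieldCongr`).
[folklore] -/
theorem exists_tensorIso (T : Triplet f g) :
    letI := ((S.residueFieldCongr T.hx).inv ≫ f.residueFieldMap T.x).hom.toAlgebra
    letI := ((S.residueFieldCongr T.hy).inv ≫ g.residueFieldMap T.y).hom.toAlgebra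
    ∃ e : T.tensor ≅ CommRingCat.of ((X.residueField T.x) ⊗[S.residueField T.s] (Y.residueField T.y)),
      T.tensorInl ≫ e.hom = CommRingCat.ofHom (Algebra.TensorProduct.includeLeftRingHom :
          (X.residueField T.x) →+* (X.residueField T.x) ⊗[S.residueField T.s] (Y.residueField T.y)) ∧
      T.tensorInr ≫ e.hom = CommRingCat.ofHom (Algebra.TensorProduct.includeRight.toRingHom :
          (Y.residueField T.y) →+* (X.residueField T.x) ⊗[S.residueField T.s] (Y.residueField T.y)) := by
  letI := ((S.residueFieldCongr T.hx).inv ≫ f.residueFieldMap T.x).hom.toAlgebra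
  letI := ((S.residueFieldCongr T.hy).inv ≫ g.residueFieldMap T.y).hom.toAlgebra
  have h := CommRingCat.isPushout_tensorProduct (S.residueField T.s) (X.residueField T.x) (Y.residueField T.y)
  exact ⟨h.isoPushout.symm, h.inl_isoPushout_inv, h.inr_isoPushout_inv⟩

/-- **If `κ(y)` is finite over `κ(s)`, `T.tensor` is Artinian** (a finite `κ(x)`-algebra). [folklore] -/
theorem isArtinianRing_tensor (T : Triplet f g)
    (hfin : letI := ((S.residueFieldCongr T.hy).inv ≫ g.residueFieldMap T.y).hom.toAlgebra
      Module.Finite (S.residueField T.s) (Y.residueField T.y)) :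
    IsArtinianRing T.tensor := by
  letI := ((S.residueFieldCongr T.hx).inv ≫ f.residueFieldMap T.x).hom.toAlgebra
  letI := ((S.residueFieldCongr T.hy).inv ≫ g.residueFieldMap T.y).hom.toAlgebra
  obtain ⟨e, -, -⟩ := exists_tensorIso T
  haveI : Module.Finite (X.residueField T.x)
      ((X.residueField T.x) ⊗[S.residueField T.s] (Y.residueField T.y)) := inferInstance
  haveI : IsArtinianRing ((X.residueField T.x) ⊗[S.residueField T.s] (Y.residueField T.y)) :=
    IsArtinianRing.of_finite (X.residueField T.x) _
  exact e.commRingCatIsoToRingEquiv.symm.isArtinianRing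

/-- With `κ(y)/κ(s)` finite, every prime of `T.tensor` is maximal. [folklore] -/
theorem isMaximal_of_finite (T : Triplet f g)
    (hfin : letI := ((S.residueFieldCongr T.hy).inv ≫ g.residueFieldMap T.y).hom.toAlgebra
      Module.Finite (S.residueField T.s) (Y.residueField T.y)) (p : Spec T.tensor) :
    p.asIdeal.IsMaximal := by
  haveI := isArtinianRing_tensor T hfin
  exact IsArtinianRing.isMaximal_of_isPrime p.asIdeal

/-- With `κ(y)/κ(s)` finite, `T.tensor` has finitely many primes: the fibre over `(x, y)` is finite. [folklore] -/
theorem finite_spec_tensor (T : Triplet f g)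
    (hfin : letI := ((S.residueFieldCongr T.hy).inv ≫ g.residueFieldMap T.y).hom.toAlgebra
      Module.Finite (S.residueField T.s) (Y.residueField T.y)) :
    Finite (Spec T.tensor) := by
  haveI := isArtinianRing_tensor T hfin
  exact inferInstanceAs (Finite (PrimeSpectrum T.tensor))

end Pullback

end Summit.ResolutionOfSingularities.ResolutionOfSingularities.Theorems.NoZeno.ExcCount

end
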